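import Summits.BirchSwinnertonDyer.BirchSwinnertonDyer.Theorems.ByReductionTypeAtTwoRankOneAtTwoBigImageOddLocalOneDoorHalvesSlice
import Summits.BirchSwinnertonDyer.BirchSwinnertonDyer.Theorems.ByReductionTypeAtTwoRankOneAtTwoBigImageOddLocalOneDoorParity
import HarnessLib

/-!
# Route ByReductionTypeAtTwo, crux `RankOneAtTwoBigImageOddLocal` (stmt-BirchSwinnertonDyer-23715), LINE v8.6 `one_door_analytic`:
# the PRINT-ONLY `2`-adic Gross–Zagier ledger of a door pair, and «`ord₂ #Ш_an(W)` is EVEN on the slice»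

Width prover seat `bsd-line-fkl-p2` g8 (2026-08-28), `--supports stmt-BirchSwinnertonDyer-23715`.  THEOREMS ONLY; nothing is asserted;
BSD is not proved by any of this.

* §1 `pairLedgerC_at` — **the `2`-adic Gross–Zagier ledger of the door pair with NO `BSD` input**: for `W` on the slice with
  `rank E(ℚ) = 1`, a door-admissible Heegner field `K` with `L(E^{(d_K)},1) ≠ 0`, ANY datum `Dt` (constant `c`), the Heegner point `P`, a
  globally minimal twin `Wd`, and ANY rational value `q_d` of `L(Wd,1)/Ω(Wd)`; modulo Gross–Zagier / Kolyvagin at `(N_E, W, K)` and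
  modularity only: `#Ш_an(W)` is a non-zero rational `q` with **`ord₂ q + ord₂ q_d = 2m + [Δ_W<0] − 2·v₂(c)`** for the (unique) exponent
  `m` of `P`.  Every quantity is computable (ENGINE L: `m`; modular symbols: `q_d`; `#Ш_an(W)` by Gross–Zagier heights), so this is a
  row-by-row CONSISTENCY IDENTITY for the census engines that presupposes no conjecture; `doorValuationC_at` (p625685) is this identity
  with `ord₂ q_d = s_d + t + 2s` unpacked from `BSD₂(Wd)`.
* §2 `even_padicValRat_shaAn_at` — at a door datum with `BSD₂(Wd)` and `Ш(Wd)` finite, granting the Cassels–Tate pairing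
  (`exists_casselsTate_pairing`): **`ord₂ #Ш_an(W)` is EVEN** and so is the `2`-adic BSD defect `ord₂ #Ш_an(W) − ord₂ #Ш(W)[2^∞]` — by
  `doorValuationC_at`, the lead's parity layer `t ≡ [Δ_W<0] (mod 2)` (`transpCount_mod_two_of_doorAdmissible`, p624716) and the evenness
  of `s_E`, `s_d` (`even_padicValNat_card_primaryComponent_sha`).  So on this slice `BSD₂` can fail, if at all, only by a power of `4`.
* §3 `even_padicValRat_shaAn_onSlice` — **for EVERY `W` on the slice of 23715, `ord₂ #Ш_an(W)` is even**, modulo the four primary facts,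
  GZK (finiteness of `Ш` of the rank-`0` twin), the Cassels–Tate pairing and `S_rankZeroTwin` (resp. the route's four rank-`0` cruxes BY
  NAME).  The squareness of `#Ш_an` is predicted by BSD + Cassels–Tate but is not a theorem in rank one; here its `2`-adic shadow on the
  slice follows from rank-`0` `BSD₂` of the twins — i.e. it is NOT additional content of the crux.

References: [GrossZagier1986] Thm. I.6.3, V.§2; [GrossLMS1991] §2 Conj. (2.2); [SilvermanAEC2009] Thm. X.4.14; [Miller2011LMS] Def. 1.1.
-/

set_option autoImplicit false

noncomputable section

open scoped Classical

set_option linter.dupNamespace false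

namespace Summit.BirchSwinnertonDyer.BirchSwinnertonDyer.Theorems.RankOneAtTwoOneDoor

open WeierstrassCurve NumberField IsDedekindDomain Rat.HeightOneSpectrum Literature.NumberTheory.EllipticCurves
  Literature.NumberTheory.EllipticCurves.ModularForms
  Literature.NumberTheory.EllipticCurves.KrizLi2019
  Literature.NumberTheory.EllipticCurves.Rank1Residual.Typed
  Summit.BirchSwinnertonDyer.Rank1Residual.F1Sign2
  Summit.BirchSwinnertonDyer.Rank1Residual.F1Sign2.TranspositionDoor
  Summit.BirchSwinnertonDyer.Rank1Residual
  Summit.BirchSwinnertonDyer.BirchSwinnertonDyer.Theses.ByReductionTypeAtTwo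

/-! ### §1 The PRINT-only `2`-adic ledger of the door pair -/

/-- **THE `2`-ADIC GROSS–ZAGIER LEDGER OF A DOOR PAIR, NO `BSD` INPUT.**  `W/ℚ` globally minimal, odd `#E(ℚ)_tors` (`hT`), odd `∏ c_ℓ`
(`hc`), analytic rank `1` (`hr`), `rank E(ℚ) = 1` (`hrQ`); `K` imaginary quadratic with `d_K` door-admissible, the Heegner hypothesis and
`L(E^{(d_K)},1) ≠ 0`; `Dt` ANY datum (`c = Dt.c`), `H`, `ι`, `P ∈ E(K)` mapping to the complex Heegner point; `Wd` a globally minimal model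
of the twist and `q_d` ANY rational with `L(Wd,1)/Ω(Wd) = q_d`; Gross–Zagier / Kolyvagin at `(N_E, W, K)`, modularity.  THEN `Ш(W)` is
finite, `rank E(K) = 1`, `P` has infinite order and a unique exact `2`-divisibility exponent, `q_d ≠ 0`, and `#Ш_an(W)` is a non-zero
rational `q` with, for the exponent `m`, **`ord₂ q + ord₂ q_d = 2m + [Δ_W<0] − 2·v₂(c)`**.  Proof: `#Ш_an(W) = 8 I² t_W²/(n k² t_K² c² w² q_d
|u| c_W)` (`shaAn_eq_heegnerIndexFormula_two_of_rank`), `k = 1`, `w = 2`, `|u| = 1`, `ord₂ I = m`, `ord₂ n + [Δ<0] = 1`, odd `t_W`,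
`t_K`, `c_W`.  [cite: GrossZagier1986, Thm. I.6.3 and V.§2] [cite: Miller2011LMS, Def. 1.1] -/
theorem pairLedgerC_at
    (hmod : hasEntireLFunction_rat)
    (W : WeierstrassCurve ℚ) [W.IsElliptic] [W.IsGloballyMinimal] [NeZero (W.conductorNorm ℤ)]
    (hT : Odd W.torsionOrder) (hc : Odd W.tamagawaProduct) (hr : W.analyticRank = 1) (hrQ : W.mordellWeilRank = 1)
    (K : Type) [Field K] [NumberField K] (hK : IsImaginaryQuadratic K)
    (hGZ : gross_zagier (W.conductorNorm ℤ) W K) (hKo : kolyvagin (W.conductorNorm ℤ) W K)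
    (hadm : DoorAdmissible W (NumberField.discr K))
    (hHN : SatisfiesHeegnerHypothesis (W.conductorNorm ℤ) K)
    (hLt : (W.quadraticTwist (NumberField.discr K : ℚ)).entireLFunction 1 ≠ 0)
    (Dt : ModularParametrizationData W (W.conductorNorm ℤ))
    (H : HeegnerDatum (W.conductorNorm ℤ) (NumberField.discr K)) (ι : K →+* ℂ)
    (P : (W.baseChange K).toAffine.Point)
    (hP : WeierstrassCurve.Affine.Point.map ι.toRatAlgHom P = heegnerPointComplex Dt H)
    (Wd : WeierstrassCurve ℚ) [Wd.IsElliptic] [Wd.IsGloballyMinimal] (Cd : VariableChange ℚ)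
    (hWd : Cd • W.quadraticTwist (NumberField.discr K : ℚ) = Wd)
    (qd : ℚ) (hqd : Wd.entireLFunction 1 / (Wd.realPeriodRat : ℂ) = (qd : ℂ)) :
    Finite W.sha ∧ (W.baseChange K).mordellWeilRank = 1 ∧ ¬ IsOfFinAddOrder P ∧
      (∃ m : ℕ, HasTwoDivisibilityUpToTorsion W K P m) ∧
      (∀ m m' : ℕ, HasTwoDivisibilityUpToTorsion W K P m → HasTwoDivisibilityUpToTorsion W K P m' → m = m') ∧
      qd ≠ 0 ∧
      ∃ q : ℚ, shaAn W = (q : ℂ) ∧ q ≠ 0 ∧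
        ∀ m : ℕ, HasTwoDivisibilityUpToTorsion W K P m →
          padicValRat 2 q + padicValRat 2 qd =
            2 * (m : ℤ) + ((if W.Δ < 0 then 1 else 0 : ℕ) : ℤ) - 2 * (padicValInt 2 Dt.c : ℤ) := by
  haveI : Fact (Nat.Prime 2) := ⟨Nat.prime_two⟩
  have hT2 : NoRationalTwoTorsion W := noRationalTwoTorsion_of_odd_torsionOrder W hT
  have h2 : Module.finrank ℚ K = 2 := hK.1
  haveI : IsTotallyComplex K := hK.2
  have hD0 : (NumberField.discr K : ℚ) ≠ 0 := by exact_mod_cast NumberField.discr_ne_zero K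
  haveI hEt : (W.quadraticTwist (NumberField.discr K : ℚ)).IsElliptic := W.isElliptic_quadraticTwist hD0
  have hLeq : Wd.entireLFunction = (W.quadraticTwist (NumberField.discr K : ℚ)).entireLFunction := by
    rw [← hWd, entireLFunction_smul]
  have hLd : Wd.entireLFunction 1 ≠ 0 := by rw [hLeq]; exact hLt
  have hΩdpos : 0 < Wd.realPeriodRat := Wd.realPeriodRat_pos_holds
  have hΩdC : (Wd.realPeriodRat : ℂ) ≠ 0 := by exact_mod_cast hΩdpos.ne'
  -- `q_d ≠ 0`
  have hqd0 : qd ≠ 0 := by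
    intro h0
    rw [h0, Rat.cast_zero, div_eq_zero_iff] at hqd
    rcases hqd with h | h
    · exact hLd h
    · exact hΩdC h
  have hc0 : Dt.c ≠ 0 := Dt.maninConstant_ne_zero_holds
  -- Gross–Zagier in the explicit `2`-adic form: `#Ш_an(W) = 8 I² t_W² / (n k² t_K² c² w² q_d |u| c_W)`
  obtain ⟨hfinW, k, hk12, hkiff, hshaW⟩ :=
    shaAn_eq_heegnerIndexFormula_two_of_rank W (W.conductorNorm ℤ) K Dt H ι P hGZ hKo hmod hK hHN hP hc0 hr hrQ hLt Wd Cd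
      hWd qd hqd
  haveI := hfinW
  ------------------------------------------------------------------ rank `E(K) = 1`, `P` of infinite order
  haveI hEK : (W.baseChange K).IsElliptic := isElliptic_baseChange' W K
  have hL0 : W.entireLFunction 1 = 0 := entireLFunction_one_eq_zero_of_analyticRank_eq_one hr
  obtain ⟨-, hderiv⟩ := leadingLCoeff_eq_deriv_of_analyticRank_eq_one hr
  have hprod := lDerivEK_eq_deriv_mul W K hmod hL0
  have hLK : LDerivEK W K ≠ 0 := by rw [hprod]; exact mul_ne_zero hderiv hLt
  have hPH : IsHeegnerPoint (W.conductorNorm ℤ) W K P := ⟨Dt, H, ι, hP⟩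
  have hPinf : ¬ IsOfFinAddOrder P :=
    (lDerivEK_ne_zero_iff_not_isOfFinAddOrder W (W.conductorNorm ℤ) K hGZ hK hHN hPH).mp hLK
  obtain ⟨hrkK, -⟩ := hKo hK hHN hPH hPinf
  have hrk : W.mordellWeilRank = 1 := hrQ
  ------------------------------------------------------------------ `#E(K)_tors` odd, `k = 1`
  have htKodd : Odd (W.baseChange K).torsionOrder := odd_torsionOrder_baseChange_of_noRationalTwoTorsion W hT2 K h2
  have hk1 : k = 1 := by
    rcases hk12 with h | h
    · exact h
    · exact absurd (hkiff.mp h) (P2.not_forall_halvable_of_odd_torsionOrder W K h2 hrkK hrk htKodd)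
  have hvtK : padicValNat 2 (W.baseChange K).torsionOrder = 0 :=
    padicValNat.eq_zero_of_not_dvd (fun h => (Nat.not_even_iff_odd.mpr htKodd) (even_iff_two_dvd.mpr h))
  ------------------------------------------------------------------ the generator of `E(K)/tors`
  obtain ⟨gK, hgK, hgenK, huniqK, -⟩ :=
    exists_generator_regulator_eq_of_mordellWeilRank_eq_one (W.baseChange K) hrkK
  ------------------------------------------------------------------ `w_K = 2`, `|u| = 1`, oddness
  have hw2 : Units.torsionOrder K = 2 :=
    Literature.NumberTheory.QuadraticFields.Quadratic.torsionOrder_eq_two_of_discr_lt_neg_four h2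
      (discr_lt_neg_four_of_doorAdmissible hadm)
  have hu1 : |(Cd.u : ℚ)| = 1 := by
    rcases W.u_eq_one_or_eq_neg_one_of_smul_quadraticTwist_of_squarefree (emod_four_of_doorAdmissible hadm)
        hadm.2.1 (good_or_mult_at_dvd_of_doorAdmissible W hadm) Wd Cd hWd with h | h <;> rw [h] <;> simp
  have hvcWn : padicValNat 2 W.tamagawaProduct = 0 :=
    padicValNat.eq_zero_of_not_dvd (fun h => (Nat.not_even_iff_odd.mpr hc) (even_iff_two_dvd.mpr h))
  ------------------------------------------------------------------ the valuation, for ANY exponent `m` of `P`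
  have hΔ0 : W.Δ ≠ 0 := W.isUnit_Δ.ne_zero
  have htW' : (W.torsionOrder : ℚ) ≠ 0 := by exact_mod_cast (W.torsionOrder_pos_holds).ne'
  have htK' : ((W.baseChange K).torsionOrder : ℚ) ≠ 0 := by
    exact_mod_cast ((W.baseChange K).torsionOrder_pos_holds).ne'
  have hcW' : (W.tamagawaProduct : ℚ) ≠ 0 := by exact_mod_cast (W.tamagawaProduct_pos_holds).ne'
  have hcM : (Dt.c : ℚ) ≠ 0 := by exact_mod_cast hc0
  have hw' : (Units.torsionOrder K : ℚ) ≠ 0 := by rw [hw2]; norm_num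
  have hua : |(Cd.u : ℚ)| ≠ 0 := abs_ne_zero.mpr Cd.u.ne_zero
  have hk' : ((k : ℕ) : ℚ) ≠ 0 := by rw [hk1]; norm_num
  have hn12 : (W.baseChange ℝ).numRealComponents = 1 ∨ (W.baseChange ℝ).numRealComponents = 2 :=
    numRealComponents_eq_one_or W
  have hn' : ((W.baseChange ℝ).numRealComponents : ℚ) ≠ 0 := by
    rcases hn12 with h | h <;> rw [h] <;> norm_num
  have h8 : padicValRat 2 (8 : ℚ) = 3 := by
    rw [show (8 : ℚ) = ((2 : ℕ) : ℚ) ^ 3 by norm_num, padicValRat.pow, padicValRat.self one_lt_two]; norm_num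
  have hvtW : padicValRat 2 (W.torsionOrder : ℚ) = 0 := by
    rw [padicValRat.of_nat, padicValNat.eq_zero_of_not_dvd
      (fun h => (Nat.not_even_iff_odd.mpr hT) (even_iff_two_dvd.mpr h))]; rfl
  have hvtKq : padicValRat 2 ((W.baseChange K).torsionOrder : ℚ) = 0 := by
    rw [padicValRat.of_nat, hvtK]; rfl
  have hvcW : padicValRat 2 (W.tamagawaProduct : ℚ) = 0 := by
    rw [padicValRat.of_nat, hvcWn]; rfl
  have hvc : padicValRat 2 (Dt.c : ℚ) = (padicValInt 2 Dt.c : ℤ) := padicValRat.of_int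
  have hvw : padicValRat 2 (Units.torsionOrder K : ℚ) = 1 := by
    rw [hw2]; exact padicValRat.self one_lt_two
  have hvu : padicValRat 2 |(Cd.u : ℚ)| = 0 := by rw [hu1]; exact padicValRat.one
  have hvk : padicValRat 2 ((k : ℕ) : ℚ) = 0 := by
    rw [hk1, Nat.cast_one]; exact padicValRat.one
  have hD1 : ((W.baseChange ℝ).numRealComponents : ℚ) * ((k : ℕ) : ℚ) ^ 2 ≠ 0 :=
    mul_ne_zero hn' (pow_ne_zero _ hk')
  have hD2 : ((W.baseChange ℝ).numRealComponents : ℚ) * ((k : ℕ) : ℚ) ^ 2 *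
      ((W.baseChange K).torsionOrder : ℚ) ^ 2 ≠ 0 := mul_ne_zero hD1 (pow_ne_zero _ htK')
  have hD3 : ((W.baseChange ℝ).numRealComponents : ℚ) * ((k : ℕ) : ℚ) ^ 2 *
      ((W.baseChange K).torsionOrder : ℚ) ^ 2 * (Dt.c : ℚ) ^ 2 ≠ 0 := mul_ne_zero hD2 (pow_ne_zero _ hcM)
  have hD4 : ((W.baseChange ℝ).numRealComponents : ℚ) * ((k : ℕ) : ℚ) ^ 2 *
      ((W.baseChange K).torsionOrder : ℚ) ^ 2 * (Dt.c : ℚ) ^ 2 * (Units.torsionOrder K : ℚ) ^ 2 ≠ 0 :=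
    mul_ne_zero hD3 (pow_ne_zero _ hw')
  have hD5 : ((W.baseChange ℝ).numRealComponents : ℚ) * ((k : ℕ) : ℚ) ^ 2 *
      ((W.baseChange K).torsionOrder : ℚ) ^ 2 * (Dt.c : ℚ) ^ 2 * (Units.torsionOrder K : ℚ) ^ 2 * qd ≠ 0 :=
    mul_ne_zero hD4 hqd0
  have hD6 : ((W.baseChange ℝ).numRealComponents : ℚ) * ((k : ℕ) : ℚ) ^ 2 *
      ((W.baseChange K).torsionOrder : ℚ) ^ 2 * (Dt.c : ℚ) ^ 2 * (Units.torsionOrder K : ℚ) ^ 2 * qd *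
      |(Cd.u : ℚ)| ≠ 0 := mul_ne_zero hD5 hua
  have hD7 : ((W.baseChange ℝ).numRealComponents : ℚ) * ((k : ℕ) : ℚ) ^ 2 *
      ((W.baseChange K).torsionOrder : ℚ) ^ 2 * (Dt.c : ℚ) ^ 2 * (Units.torsionOrder K : ℚ) ^ 2 * qd *
      |(Cd.u : ℚ)| * (W.tamagawaProduct : ℚ) ≠ 0 := mul_ne_zero hD6 hcW'
  have hden : padicValRat 2 (((W.baseChange ℝ).numRealComponents : ℚ) * ((k : ℕ) : ℚ) ^ 2 *
      ((W.baseChange K).torsionOrder : ℚ) ^ 2 * (Dt.c : ℚ) ^ 2 * (Units.torsionOrder K : ℚ) ^ 2 * qd *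
      |(Cd.u : ℚ)| * (W.tamagawaProduct : ℚ)) =
      padicValRat 2 ((W.baseChange ℝ).numRealComponents : ℚ) + 2 + 2 * (padicValInt 2 Dt.c : ℤ) + padicValRat 2 qd := by
    rw [padicValRat.mul hD6 hcW', padicValRat.mul hD5 hua, padicValRat.mul hD4 hqd0,
      padicValRat.mul hD3 (pow_ne_zero _ hw'), padicValRat.mul hD2 (pow_ne_zero _ hcM),
      padicValRat.mul hD1 (pow_ne_zero _ htK'), padicValRat.mul hn' (pow_ne_zero _ hk'),
      padicValRat.pow, padicValRat.pow, padicValRat.pow, padicValRat.pow,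
      hvk, hvtKq, hvc, hvw, hvu, hvcW]
    ring
  -- `[Δ<0]` and `v₂ n` add up to `1`
  have hsign : padicValRat 2 ((W.baseChange ℝ).numRealComponents : ℚ) + (if W.Δ < 0 then 1 else 0 : ℕ) = 1 := by
    rcases lt_or_gt_of_ne hΔ0 with hneg | hpos
    · rw [if_pos hneg, P2.numRealComponents_eq_one_of_Δ_neg hneg, Nat.cast_one, padicValRat.one]; norm_num
    · rw [if_neg (not_lt.mpr hpos.le), P2.numRealComponents_eq_two_of_Δ_pos hpos, padicValRat.self one_lt_two]
      norm_num
  -- `#Ш_an(W) ≠ 0`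
  have hshaW_ne : shaAn W ≠ 0 := by
    rw [shaAn_def]
    refine div_ne_zero (mul_ne_zero (W.leadingLCoeff_ne_zero_holds (hmod W))
      (pow_ne_zero 2 (by exact_mod_cast W.torsionOrder_pos_holds.ne'))) ?_
    exact mul_ne_zero (mul_ne_zero (by exact_mod_cast W.realPeriodRat_pos_holds.ne')
      (by exact_mod_cast W.tamagawaProduct_pos_holds.ne')) (by exact_mod_cast W.regulator_pos'.ne')
  -- the door's rational
  set q : ℚ := 8 * ((AddSubgroup.zmultiples P).index : ℚ) ^ 2 * (W.torsionOrder : ℚ) ^ 2 /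
      (((W.baseChange ℝ).numRealComponents : ℚ) * (k : ℚ) ^ 2 *
        ((W.baseChange K).torsionOrder : ℚ) ^ 2 * (Dt.c : ℚ) ^ 2 *
        (Units.torsionOrder K : ℚ) ^ 2 * qd * |(Cd.u : ℚ)| * (W.tamagawaProduct : ℚ)) with hq_def
  have hval : ∀ {m : ℕ} {Q : (W.baseChange K).toAffine.Point},
      P - (2 ^ m) • Q ∈ AddCommGroup.torsion (W.baseChange K).toAffine.Point →
      (¬ ∃ Q' : (W.baseChange K).toAffine.Point,
          Q - 2 • Q' ∈ AddCommGroup.torsion (W.baseChange K).toAffine.Point) →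
      padicValRat 2 q =
        3 + 2 * (m : ℤ) - (padicValRat 2 ((W.baseChange ℝ).numRealComponents : ℚ) + 2 + 2 * (padicValInt 2 Dt.c : ℤ) +
          padicValRat 2 qd) := by
    intro m Q hPQ hQ
    obtain ⟨hI0, hvIdx⟩ := padicValNat_index_of_twoDivisibility (W.baseChange K) hgK hgenK hPQ hQ
    have hI' : ((AddSubgroup.zmultiples P).index : ℚ) ≠ 0 := by exact_mod_cast hI0
    have hvI : padicValRat 2 ((AddSubgroup.zmultiples P).index : ℚ) = (m : ℤ) := by
      rw [padicValRat.of_nat, hvIdx, hvtK]; push_cast; ring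
    have hA1 : (8 : ℚ) * ((AddSubgroup.zmultiples P).index : ℚ) ^ 2 ≠ 0 :=
      mul_ne_zero (by norm_num) (pow_ne_zero _ hI')
    have hA2 : (8 : ℚ) * ((AddSubgroup.zmultiples P).index : ℚ) ^ 2 * (W.torsionOrder : ℚ) ^ 2 ≠ 0 :=
      mul_ne_zero hA1 (pow_ne_zero _ htW')
    have hnum : padicValRat 2 ((8 : ℚ) * ((AddSubgroup.zmultiples P).index : ℚ) ^ 2 * (W.torsionOrder : ℚ) ^ 2) =
        3 + 2 * (m : ℤ) := by
      rw [padicValRat.mul hA1 (pow_ne_zero _ htW'), padicValRat.mul (by norm_num) (pow_ne_zero _ hI'),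
        padicValRat.pow, padicValRat.pow, h8, hvI, hvtW]
      ring
    rw [hq_def, padicValRat.div hA2 hD7, hnum, hden]
  obtain ⟨m₀, Q₀, hPQ₀, hQ₀⟩ := exists_twoDivisibility_of_rankOne (W.baseChange K) hgenK huniqK hPinf
  have hq0 : q ≠ 0 := by
    intro h0
    rw [h0, Rat.cast_zero] at hshaW
    exact hshaW_ne hshaW
  refine ⟨hfinW, hrkK, hPinf, ⟨m₀, Q₀, hPQ₀, hQ₀⟩,
    fun m m' hm hm' => hasTwoDivisibilityUpToTorsion_unique W K hrkK P hm hm', hqd0, q, hshaW, hq0, ?_⟩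
  rintro m ⟨Q, hPQ, hQ⟩
  have hQ' : ¬ ∃ Q' : (W.baseChange K).toAffine.Point,
      Q - 2 • Q' ∈ AddCommGroup.torsion (W.baseChange K).toAffine.Point := hQ
  rw [hval hPQ hQ']
  have hv' := hsign
  push_cast at hv' ⊢
  linarith

/-- **Parity of the pair ledger (PRINT only)**: in the setting of `pairLedgerC_at`, `ord₂ #Ш_an(W) + ord₂ q_d ≡ [Δ_W<0] (mod 2)` —
for every rational value `q` of `#Ш_an(W)` there is an integer `r` with `ord₂ q + ord₂ q_d = 2r + [Δ_W<0]`.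
[cite: GrossZagier1986, V.§2] -/
theorem padicValRat_shaAn_add_twin_parity_at
    (hmod : hasEntireLFunction_rat)
    (W : WeierstrassCurve ℚ) [W.IsElliptic] [W.IsGloballyMinimal] [NeZero (W.conductorNorm ℤ)]
    (hT : Odd W.torsionOrder) (hc : Odd W.tamagawaProduct) (hr : W.analyticRank = 1) (hrQ : W.mordellWeilRank = 1)
    (K : Type) [Field K] [NumberField K] (hK : IsImaginaryQuadratic K)
    (hGZ : gross_zagier (W.conductorNorm ℤ) W K) (hKo : kolyvagin (W.conductorNorm ℤ) W K)
    (hadm : DoorAdmissible W (NumberField.discr K))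
    (hHN : SatisfiesHeegnerHypothesis (W.conductorNorm ℤ) K)
    (hLt : (W.quadraticTwist (NumberField.discr K : ℚ)).entireLFunction 1 ≠ 0)
    (Dt : ModularParametrizationData W (W.conductorNorm ℤ))
    (H : HeegnerDatum (W.conductorNorm ℤ) (NumberField.discr K)) (ι : K →+* ℂ)
    (P : (W.baseChange K).toAffine.Point)
    (hP : WeierstrassCurve.Affine.Point.map ι.toRatAlgHom P = heegnerPointComplex Dt H)
    (Wd : WeierstrassCurve ℚ) [Wd.IsElliptic] [Wd.IsGloballyMinimal] (Cd : VariableChange ℚ)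
    (hWd : Cd • W.quadraticTwist (NumberField.discr K : ℚ) = Wd)
    (qd : ℚ) (hqd : Wd.entireLFunction 1 / (Wd.realPeriodRat : ℂ) = (qd : ℂ))
    (q : ℚ) (hq : shaAn W = (q : ℂ)) :
    ∃ r : ℤ, padicValRat 2 q + padicValRat 2 qd = 2 * r + ((if W.Δ < 0 then 1 else 0 : ℕ) : ℤ) := by
  obtain ⟨-, -, -, ⟨m, hm⟩, -, -, q₀, hq₀, -, hval⟩ :=
    pairLedgerC_at hmod W hT hc hr hrQ K hK hGZ hKo hadm hHN hLt Dt H ι P hP Wd Cd hWd qd hqd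
  have hqq : q = q₀ := by exact_mod_cast hq.symm.trans hq₀
  subst hqq
  exact ⟨(m : ℤ) - padicValInt 2 Dt.c, by rw [hval m hm]; ring⟩

/-! ### §2 `ord₂ #Ш_an(W)` is even at a door datum (Cassels–Tate + the parity of the transposition count) -/

/-- **`ord₂ #Ш_an(W)` IS EVEN at a door datum, and so is the `2`-adic BSD defect.**  Hypotheses of `doorValuationC_at` (door datum with
`BSD₂(Wd)`), plus `Ш(Wd)` finite and the Cassels–Tate pairing (`exists_casselsTate_pairing`).  Then for every rational value `q` of
`#Ш_an(W)`: `ord₂ q` is even and `ord₂ q − ord₂ #Ш(W)[2^∞]` is even — from `ord₂ q = 2m + [Δ_W<0] − s_d − t − 2s − 2·v₂(c)`,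
`t ≡ [Δ_W<0] (mod 2)` (lead g7, `transpCount_mod_two_of_doorAdmissible`) and `s_E`, `s_d` even (`even_padicValNat_card_primaryComponent_sha`).
So `BSD₂(W)` can fail at such a curve only by a power of `4`. [cite: SilvermanAEC2009, Thm. X.4.14] [cite: GrossZagier1986, V.§2] -/
theorem even_padicValRat_shaAn_at (hCT : exists_casselsTate_pairing (K := ℚ))
    (hmod : hasEntireLFunction_rat) (hTam : DoorTwistTamagawaAtTwo)
    (W : WeierstrassCurve ℚ) [W.IsElliptic] [W.IsGloballyMinimal] [NeZero (W.conductorNorm ℤ)]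
    (hT : Odd W.torsionOrder) (hc : Odd W.tamagawaProduct) (hr : W.analyticRank = 1) (hrQ : W.mordellWeilRank = 1)
    (K : Type) [Field K] [NumberField K] (hK : IsImaginaryQuadratic K)
    (hGZ : gross_zagier (W.conductorNorm ℤ) W K) (hKo : kolyvagin (W.conductorNorm ℤ) W K)
    (hadm : DoorAdmissible W (NumberField.discr K))
    (hHN : SatisfiesHeegnerHypothesis (W.conductorNorm ℤ) K)
    (hLt : (W.quadraticTwist (NumberField.discr K : ℚ)).entireLFunction 1 ≠ 0)
    (Dt : ModularParametrizationData W (W.conductorNorm ℤ))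
    (H : HeegnerDatum (W.conductorNorm ℤ) (NumberField.discr K)) (ι : K →+* ℂ)
    (P : (W.baseChange K).toAffine.Point)
    (hP : WeierstrassCurve.Affine.Point.map ι.toRatAlgHom P = heegnerPointComplex Dt H)
    (Wd : WeierstrassCurve ℚ) [Wd.IsElliptic] [Wd.IsGloballyMinimal] (Cd : VariableChange ℚ)
    (hWd : Cd • W.quadraticTwist (NumberField.discr K : ℚ) = Wd) (hBd : BSDp Wd 2) (hfinD : Finite Wd.sha)
    (q : ℚ) (hq : shaAn W = (q : ℂ)) :
    Even (padicValRat 2 q) ∧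
      Even (padicValRat 2 q - (padicValNat 2 (Nat.card (AddCommGroup.primaryComponent W.sha 2)) : ℤ)) := by
  obtain ⟨hfinW, -, -, -, ⟨m, hm⟩, -, q₀, hq₀, -, hval⟩ :=
    doorValuationC_at hmod hTam W hT hc hr hrQ K hK hGZ hKo hadm hHN hLt Dt H ι P hP Wd Cd hWd hBd
  haveI := hfinW
  haveI := hfinD
  have hqq : q = q₀ := by exact_mod_cast hq.symm.trans hq₀
  subst hqq
  have hv := hval m hm
  obtain ⟨a, ha⟩ := even_padicValNat_card_primaryComponent_sha hCT W
  obtain ⟨b, hb⟩ := even_padicValNat_card_primaryComponent_sha hCT Wd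
  have ht := transpCount_mod_two_of_doorAdmissible W hadm
  have ht' : (transpCount W (NumberField.discr K) : ℤ) =
      2 * ((transpCount W (NumberField.discr K) / 2 : ℕ) : ℤ) + ((if W.Δ < 0 then 1 else 0 : ℕ) : ℤ) := by
    have h := Nat.div_add_mod (transpCount W (NumberField.discr K)) 2
    rw [ht] at h
    exact_mod_cast h.symm
  rw [hb, ht'] at hv
  refine ⟨⟨(m : ℤ) - b - ((transpCount W (NumberField.discr K) / 2 : ℕ) : ℤ) - identCount W (NumberField.discr K) -
      padicValInt 2 Dt.c, ?_⟩, ⟨(m : ℤ) - a - b - ((transpCount W (NumberField.discr K) / 2 : ℕ) : ℤ) -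
      identCount W (NumberField.discr K) - padicValInt 2 Dt.c, ?_⟩⟩
  · rw [hv]; push_cast; ring
  · rw [hv, ha]; push_cast; ring

/-! ### §3 `ord₂ #Ш_an(W)` is even on the whole slice -/

/-- **For EVERY `W` on the slice of 23715, `ord₂ #Ш_an(W)` is even** (and the `2`-adic BSD defect `ord₂ #Ш_an(W) − ord₂ #Ш(W)[2^∞]` is
even), modulo the four primary facts (`gross_zagier`, `kolyvagin`, `exists_isNewformOf`, Hoffstein–Luo), GZK (finiteness of `Ш` of the
rank-`0` twin), the Cassels–Tate pairing and `S_rankZeroTwin`: the door package of `exists_doorPackage_onSlice_primary` and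
`even_padicValRat_shaAn_at`.  BSD predicts `#Ш_an` is a square; on this slice its `2`-adic parity is NOT extra content of the crux — it
follows from rank-`0` `BSD₂` of the twins.  Conditional by design. [cite: SilvermanAEC2009, Thm. X.4.14] [cite: Miller2011LMS, Def. 1.1] -/
theorem even_padicValRat_shaAn_onSlice (hCT : exists_casselsTate_pairing (K := ℚ))
    (hGZ : ∀ (N : ℕ) [NeZero N] (W : WeierstrassCurve ℚ) (K : Type) [Field K] [NumberField K], gross_zagier N W K)
    (hKo : ∀ (N : ℕ) [NeZero N] (W : WeierstrassCurve ℚ) (K : Type) [Field K] [NumberField K], kolyvagin N W K)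
    (hGZK : rank_eq_analyticRank_of_analyticRank_le_one) (hnf : exists_isNewformOf)
    (hHL : HoffsteinLuo1997_exists_twist_L_one_ne_zero) (hZ : S_rankZeroTwin) :
    ∀ (W : WeierstrassCurve ℚ) [W.IsElliptic] [W.IsGloballyMinimal], ¬ W.HasCM →
      (∀ n : ℕ, W.HasSurjectiveModNGaloisRep ((2 ^ n : ℕ) : ℤ)) → Odd W.torsionOrder → Odd W.tamagawaProduct →
      W.analyticRank = 1 → ∀ q : ℚ, shaAn W = (q : ℂ) →
        Even (padicValRat 2 q) ∧
          Even (padicValRat 2 q - (padicValNat 2 (Nat.card (AddCommGroup.primaryComponent W.sha 2)) : ℤ)) := by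
  intro W _ _ hCM hsurj hT hc hr q hq
  have hmod : hasEntireLFunction_rat := hasEntireLFunction_rat_of_exists_isNewformOf hnf
  haveI hN : NeZero (W.conductorNorm ℤ) := ⟨(W.conductorNorm_pos_holds).ne'⟩
  obtain ⟨hrk, K, _iF, _iN, hK, hadm, hHN, hLt, Dt, H, ι, P, Cd, hP, _, _, hBd⟩ :=
    exists_doorPackage_onSlice_primary hGZ hKo hnf hHL hZ W hCM hr
  have hD0 : (NumberField.discr K : ℚ) ≠ 0 := by exact_mod_cast NumberField.discr_ne_zero K
  haveI hEt : (W.quadraticTwist (NumberField.discr K : ℚ)).IsElliptic := W.isElliptic_quadraticTwist hD0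
  have hLeq : (Cd • W.quadraticTwist (NumberField.discr K : ℚ)).entireLFunction =
      (W.quadraticTwist (NumberField.discr K : ℚ)).entireLFunction := by rw [entireLFunction_smul]
  have hrd : (Cd • W.quadraticTwist (NumberField.discr K : ℚ)).analyticRank = 0 :=
    ((Cd • W.quadraticTwist _).analyticRank_eq_zero_iff_holds (hmod _)).2 (by rw [hLeq]; exact hLt)
  have hfinD : Finite (Cd • W.quadraticTwist (NumberField.discr K : ℚ)).sha := (hGZK _ (by rw [hrd]; exact zero_le_one)).2
  exact even_padicValRat_shaAn_at hCT hmod doorTwistTamagawaAtTwo W hT hc hr hrk K hK (hGZ _ W K) (hKo _ W K) hadm hHN hLt Dt H ι P hP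
    _ Cd rfl hBd hfinD q hq

/-- The same with the route's four rank-`0` cruxes BY NAME in place of `S_rankZeroTwin`.  Conditional by design.
[cite: SilvermanAEC2009, Thm. X.4.14] [cite: Miller2011LMS, Def. 1.1] -/
theorem even_padicValRat_shaAn_onSlice_of_rankZero_cruxes (hCT : exists_casselsTate_pairing (K := ℚ))
    (hGZ : ∀ (N : ℕ) [NeZero N] (W : WeierstrassCurve ℚ) (K : Type) [Field K] [NumberField K], gross_zagier N W K)
    (hKo : ∀ (N : ℕ) [NeZero N] (W : WeierstrassCurve ℚ) (K : Type) [Field K] [NumberField K], kolyvagin N W K)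
    (hGZK : rank_eq_analyticRank_of_analyticRank_le_one) (hnf : exists_isNewformOf)
    (hHL : HoffsteinLuo1997_exists_twist_L_one_ne_zero)
    (hZ4 : GoodOrdinaryRankZeroAtTwo ∧ MultiplicativeRankZeroAtTwo ∧ SupersingularRankZeroAtTwo ∧ AdditiveRankZeroAtTwo) :
    ∀ (W : WeierstrassCurve ℚ) [W.IsElliptic] [W.IsGloballyMinimal], ¬ W.HasCM →
      (∀ n : ℕ, W.HasSurjectiveModNGaloisRep ((2 ^ n : ℕ) : ℤ)) → Odd W.torsionOrder → Odd W.tamagawaProduct →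
      W.analyticRank = 1 → ∀ q : ℚ, shaAn W = (q : ℂ) → Even (padicValRat 2 q) :=
  fun W _ _ hCM hsurj hT hc hr q hq =>
    (even_padicValRat_shaAn_onSlice hCT hGZ hKo hGZK hnf hHL (rankZeroTwin_of_rankZero_cruxes hZ4) W hCM hsurj hT hc hr q hq).1

end Summit.BirchSwinnertonDyer.BirchSwinnertonDyer.Theorems.RankOneAtTwoOneDoor

end
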